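/-
Copyright (c) 2026 the pub-hodgecm-mathlib formalisation cell (harness21).  Prover seat hodgecm-mathlib-K2E1-p16 (g2), 2026-09-04 (R90-TF section
S8 «ContSpec-n½»; dealer R90-CS-plan (g0), LEAD K2E1-plan (g7), auditor R90-CS-audit1 (g0); «#8₂» = the `H`-side (`U(Φ₂)`) twin of
S8B#8 ★ `Theorems/R90S8CharLineOfOneDim`).
-/
import Summits.HodgeConjecture.HodgeConjecture.Theorems.R90S8CharLineOfOneDim   -- ★ p861561 S8B#8 `charLine_of_isOneDimensional` (rank 3) and its imports: ★ `exists_eq_ofChar_of_isOneDimensional`, ★ `cm_exists_eq_cmDetChar_antidiagOne_two`, ★ `cmDatum`, ★ `qsForm`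
import HarnessLib

/-!
# S8B#8₂ — a one-dimensional discrete automorphic representation of `U(Φ₂) = U(1,1)` is a character line `ℂ·[ψ ∘ det]`

Cell `hodgecm-mathlib`, crux H413 = `stmt-HodgeConjecture-24833`, R90-TF section S8 «ContSpec-n½» (Rogawski 1990 §13.9: the residual
spectrum; `H`-side `U(1,1)` for the socket S8B#4 `sock_S8_resH_classification` of FILE B `Cruxes/H413/Lines/R90_S8_ResidualSpectrumU3B.lean`,
whose `charLine₂ L ψ hψ μ₂` is by definition the right-hand side below).  The `H`-SIDE TWIN of ★ S8B#8
`Theorems/R90S8CharLineOfOneDim :: charLine_of_isOneDimensional` (rank `3`): it isolates the bookkeeping half «one-dimensional ⇒ character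
line» of S8B#4, so that S8B#4's genuine content is exactly «a residual automorphic representation of `U(1,1)` is one-dimensional».

STATEMENT: for the quasi-split `𝒢₂ = U(Φ₂)` of a CM field `L` (`UnitaryGroup.cmDatum L 2 Φ₂`, `Φ₂ = antidiag(1,1)` in the literal spelling
`(i, j) ↦ [i + j + 1 = 2]` of the H413 letters) and an automorphic measure `μ₂`, every `P : DiscreteAutomorphicRep 𝒢₂ μ₂` with `dim_ℂ P = 1`
satisfies `P.space = (cmDetChar L 2 Φ₂ ψ hψ _).lineSubrep μ₂` for an automorphic character `ψ` of `U(1)_{L∕L⁺}(𝔸)` — and conversely such a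
line IS one-dimensional (`isOneDimensional_of_eq_charLine₂`, ★ `isOneDimensional_ofChar`); the same converse at rank `3`
(`isOneDimensional_of_eq_charLine₃`, and the iff `isOneDimensional_iff_exists_eq_charLine₃` with ★ S8B#8) is recorded for FILE B's
«(i) ⟺ character line» reading of §13.9.
[Rogawski1990 §13.3 p. 202 «`ξ(h) = η(det₀ h) ψ(det h)`», §13.9 p. 229; GelbartRogawski1991 §3.1 Remark p. 457.]

PROOF: ★ `exists_eq_ofChar_of_isOneDimensional` (`P = ofChar Θ μ₂`) ∘ ★ `cm_exists_eq_cmDetChar_antidiagOne_two` (`Θ = cmDetChar θ`: Dieudonné's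
transvections kill `SU(1,1)(𝔸)` ★ `AdelicCharactersDetQuasiSplit`, the hyperbolic frame inverts `det`, ★ `UnitaryGroupDetCharacterSection` §3–§4)
∘ ★ `ofChar_space` (`rfl`).  The pin `(𝒢 := 𝒢₂)` reads ★ `cmDetChar` (typed over the rfl-equal generic datum `adelicGroupData L⁺ L c 2 Φ₂`)
against `𝒢₂`'s automorphic-measure instance, exactly as in ★ S8B#8.

THEOREMS ONLY (no definition, no instance, no notation, no named fact, no `sorry`); namespace `Summit.HodgeConjecture.HodgeConjecture.R90.S8`.
Lane `--kind proof --supports stmt-HodgeConjecture-24833 --as helper`.  HONEST LABEL: plumbing over ★ bricks; HC_CM is proved only modulo the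
7 printed citations (2 remaining named inputs: hLiu418 = `stmt-HodgeConjecture-24832`, h413 = `stmt-HodgeConjecture-24833`) until rung 0 closes;
this file books nothing and discharges nothing booked.

## References
* [Rogawski1990] J. D. Rogawski, *Automorphic Representations of Unitary Groups in Three Variables*, Ann. of Math. Stud. 123 (1990), §13.3 p. 202, §13.9 p. 229.
* [GelbartRogawski1991] S. Gelbart, J. Rogawski, Invent. Math. 105 (1991), §3.1 Remark p. 457 L9–13.
* [BorelJacquet1979] A. Borel, H. Jacquet, *Automorphic forms and automorphic representations*, Corvallis (1979), §4.6.
* [Mok2014] C. P. Mok, Mem. AMS 235 (2015), §1 Notation p. 5 (the form `Φ_N`).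
-/

set_option autoImplicit false
set_option linter.dupNamespace false  -- the mandated namespace `…HodgeConjecture.HodgeConjecture.R90.S8` (LEAD #1 L1) repeats the summit's segment

noncomputable section

open NumberField MeasureTheory
open Literature.NumberTheory.Automorphic Literature.NumberTheory.Automorphic.UnitaryGroup
open Literature.NumberTheory.Automorphic.Arthur2013.Leaves.TECR
open Literature.NumberTheory.Rogawski1990

namespace Summit.HodgeConjecture.HodgeConjecture.R90.S8

variable (L : Type) [Field L] [NumberField L] [IsCMField L]

/-- **S8B#8₂ `charLine₂_of_isOneDimensional` — a one-dimensional discrete automorphic representation of `U(Φ₂) = U(1,1)` IS a character line.**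
For `𝒢₂ = U(Φ₂)` of the CM field `L` (★ `UnitaryGroup.cmDatum L 2 Φ₂`, `Φ₂ = antidiag(1,1)`) and an automorphic measure `μ₂`, every
`P : DiscreteAutomorphicRep 𝒢₂ μ₂` with `dim_ℂ P = 1` (★ `IsOneDimensional`) satisfies `P.space = (cmDetChar L 2 Φ₂ ψ hψ _).lineSubrep μ₂` — FILE B's
`charLine₂ L ψ hψ μ₂` — for an automorphic character `ψ` of `U(1)_{L∕L⁺}(𝔸)` («`ξ(h) = η(det₀ h) ψ(det h)`»: a character of `U(2)` is a character of
`U(1)` through `det`).  Proof: ★ `exists_eq_ofChar_of_isOneDimensional`, ★ `cm_exists_eq_cmDetChar_antidiagOne_two`, ★ `ofChar_space`.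
[cite: Rogawski1990, §13.3 p. 202; §13.9 p. 229] [cite: GelbartRogawski1991, §3.1 Remark p. 457 L9–13] [cite: BorelJacquet1979, §4.6] -/
theorem charLine₂_of_isOneDimensional
    (μ₂ : Measure (UnitaryGroup.cmDatum L 2 (Matrix.of fun i j : Fin 2 => if i.val + j.val + 1 = 2 then (1 : L) else 0)).automorphicQuotient)
    [(UnitaryGroup.cmDatum L 2 (Matrix.of fun i j : Fin 2 => if i.val + j.val + 1 = 2 then (1 : L) else 0)).IsAutomorphicMeasure μ₂]
    (P : DiscreteAutomorphicRep (UnitaryGroup.cmDatum L 2 (Matrix.of fun i j : Fin 2 => if i.val + j.val + 1 = 2 then (1 : L) else 0)) μ₂)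
    (h1 : P.IsOneDimensional) :
    ∃ (ψ : ↥(TorusDict.torus (IsCMField.complexConj L)) →ₜ* ℂˣ) (hψ : TorusDict.IsAutomorphic (IsCMField.complexConj L) ψ),
      P.space = AdelicGroupData.AutomorphicCharacter.lineSubrep
        (𝒢 := UnitaryGroup.cmDatum L 2 (Matrix.of fun i j : Fin 2 => if i.val + j.val + 1 = 2 then (1 : L) else 0))
        (cmDetChar L 2 (Matrix.of fun i j : Fin 2 => if i.val + j.val + 1 = 2 then (1 : L) else 0) ψ hψ
          (isUnit_antidiagOne_det L 2).ne_zero) μ₂ := by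
  obtain ⟨Θ, hΘ⟩ := DiscreteAutomorphicRep.exists_eq_ofChar_of_isOneDimensional μ₂ P h1
  obtain ⟨θ, hθ, hΘθ⟩ := cm_exists_eq_cmDetChar_antidiagOne_two L Θ
  refine ⟨θ, hθ, ?_⟩
  rw [hΘ, DiscreteAutomorphicRep.ofChar_space, hΘθ]

/-- **Converse bookkeeping at rank `2`: a discrete automorphic representation of `U(Φ₂)` whose space IS a character line `ℂ·[ψ ∘ det]` is
one-dimensional** (★ `isOneDimensional_ofChar` through ★ `ofChar_space`; `P = ofChar _ μ₂` by ★ `eq_of_space_eq'`-free rewriting of `finrank`).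
[cite: BorelJacquet1979, §4.6] [cite: Rogawski1990, §13.3 p. 202] -/
theorem isOneDimensional_of_eq_charLine₂
    (μ₂ : Measure (UnitaryGroup.cmDatum L 2 (Matrix.of fun i j : Fin 2 => if i.val + j.val + 1 = 2 then (1 : L) else 0)).automorphicQuotient)
    [(UnitaryGroup.cmDatum L 2 (Matrix.of fun i j : Fin 2 => if i.val + j.val + 1 = 2 then (1 : L) else 0)).IsAutomorphicMeasure μ₂]
    (P : DiscreteAutomorphicRep (UnitaryGroup.cmDatum L 2 (Matrix.of fun i j : Fin 2 => if i.val + j.val + 1 = 2 then (1 : L) else 0)) μ₂)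
    (ψ : ↥(TorusDict.torus (IsCMField.complexConj L)) →ₜ* ℂˣ) (hψ : TorusDict.IsAutomorphic (IsCMField.complexConj L) ψ)
    (hP : P.space = AdelicGroupData.AutomorphicCharacter.lineSubrep
        (𝒢 := UnitaryGroup.cmDatum L 2 (Matrix.of fun i j : Fin 2 => if i.val + j.val + 1 = 2 then (1 : L) else 0))
        (cmDetChar L 2 (Matrix.of fun i j : Fin 2 => if i.val + j.val + 1 = 2 then (1 : L) else 0) ψ hψ
          (isUnit_antidiagOne_det L 2).ne_zero) μ₂) :
    P.IsOneDimensional := by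
  unfold DiscreteAutomorphicRep.IsOneDimensional
  rw [hP]
  exact DiscreteAutomorphicRep.isOneDimensional_ofChar
    (𝒢 := UnitaryGroup.cmDatum L 2 (Matrix.of fun i j : Fin 2 => if i.val + j.val + 1 = 2 then (1 : L) else 0)) _ μ₂

/-- **Converse bookkeeping at rank `3`: a discrete automorphic representation of `U(Φ₃)` whose space IS a character line `ℂ·[ψ ∘ det]`
(FILE B's `charLine₃ L ψ hψ μ`) is one-dimensional** — with ★ S8B#8 `charLine_of_isOneDimensional` this is the «(i) ⟺ character line» reading of
§13.9: `P.IsOneDimensional ↔ ∃ ψ hψ, P.space = charLine₃ L ψ hψ μ`. [cite: BorelJacquet1979, §4.6] [cite: Rogawski1990, §13.9 p. 229] -/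
theorem isOneDimensional_of_eq_charLine₃
    (μ : Measure (UnitaryGroup.cmDatum L 3 (qsForm L)).automorphicQuotient) [(UnitaryGroup.cmDatum L 3 (qsForm L)).IsAutomorphicMeasure μ]
    (P : DiscreteAutomorphicRep (UnitaryGroup.cmDatum L 3 (qsForm L)) μ)
    (ψ : ↥(TorusDict.torus (IsCMField.complexConj L)) →ₜ* ℂˣ) (hψ : TorusDict.IsAutomorphic (IsCMField.complexConj L) ψ)
    (hP : P.space = AdelicGroupData.AutomorphicCharacter.lineSubrep (𝒢 := UnitaryGroup.cmDatum L 3 (qsForm L))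
        (cmDetChar L 3 (qsForm L) ψ hψ (isUnit_antidiagOne_det L 3).ne_zero) μ) :
    P.IsOneDimensional := by
  unfold DiscreteAutomorphicRep.IsOneDimensional
  rw [hP]
  exact DiscreteAutomorphicRep.isOneDimensional_ofChar (𝒢 := UnitaryGroup.cmDatum L 3 (qsForm L)) _ μ

/-- **§13.9 (i), read as an iff at rank `3`: a discrete automorphic representation of `U(Φ₃)` is one-dimensional IFF its space is a character line
`ℂ·[ψ ∘ det]`** (FILE B's `charLine₃ L ψ hψ μ`) — ★ S8B#8 `charLine_of_isOneDimensional` and `isOneDimensional_of_eq_charLine₃` BY NAME.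
[cite: Rogawski1990, §13.9 p. 229 (i); §13.3 p. 202] [cite: BorelJacquet1979, §4.6] -/
theorem isOneDimensional_iff_exists_eq_charLine₃
    (μ : Measure (UnitaryGroup.cmDatum L 3 (qsForm L)).automorphicQuotient) [(UnitaryGroup.cmDatum L 3 (qsForm L)).IsAutomorphicMeasure μ]
    (P : DiscreteAutomorphicRep (UnitaryGroup.cmDatum L 3 (qsForm L)) μ) :
    P.IsOneDimensional ↔
      ∃ (ψ : ↥(TorusDict.torus (IsCMField.complexConj L)) →ₜ* ℂˣ) (hψ : TorusDict.IsAutomorphic (IsCMField.complexConj L) ψ),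
        P.space = AdelicGroupData.AutomorphicCharacter.lineSubrep (𝒢 := UnitaryGroup.cmDatum L 3 (qsForm L))
          (cmDetChar L 3 (qsForm L) ψ hψ (isUnit_antidiagOne_det L 3).ne_zero) μ :=
  ⟨charLine_of_isOneDimensional L μ P, fun ⟨ψ, hψ, hP⟩ => isOneDimensional_of_eq_charLine₃ L μ P ψ hψ hP⟩

/-- **The same iff at rank `2` (`H`-side `U(1,1)`)**: `P.IsOneDimensional ↔ ∃ ψ hψ, P.space = charLine₂ L ψ hψ μ₂` — `charLine₂_of_isOneDimensional` and
`isOneDimensional_of_eq_charLine₂` BY NAME. [cite: Rogawski1990, §13.3 p. 202] [cite: BorelJacquet1979, §4.6] -/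
theorem isOneDimensional_iff_exists_eq_charLine₂
    (μ₂ : Measure (UnitaryGroup.cmDatum L 2 (Matrix.of fun i j : Fin 2 => if i.val + j.val + 1 = 2 then (1 : L) else 0)).automorphicQuotient)
    [(UnitaryGroup.cmDatum L 2 (Matrix.of fun i j : Fin 2 => if i.val + j.val + 1 = 2 then (1 : L) else 0)).IsAutomorphicMeasure μ₂]
    (P : DiscreteAutomorphicRep (UnitaryGroup.cmDatum L 2 (Matrix.of fun i j : Fin 2 => if i.val + j.val + 1 = 2 then (1 : L) else 0)) μ₂) :
    P.IsOneDimensional ↔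
      ∃ (ψ : ↥(TorusDict.torus (IsCMField.complexConj L)) →ₜ* ℂˣ) (hψ : TorusDict.IsAutomorphic (IsCMField.complexConj L) ψ),
        P.space = AdelicGroupData.AutomorphicCharacter.lineSubrep
          (𝒢 := UnitaryGroup.cmDatum L 2 (Matrix.of fun i j : Fin 2 => if i.val + j.val + 1 = 2 then (1 : L) else 0))
          (cmDetChar L 2 (Matrix.of fun i j : Fin 2 => if i.val + j.val + 1 = 2 then (1 : L) else 0) ψ hψ
            (isUnit_antidiagOne_det L 2).ne_zero) μ₂ :=
  ⟨charLine₂_of_isOneDimensional L μ₂ P, fun ⟨ψ, hψ, hP⟩ => isOneDimensional_of_eq_charLine₂ L μ₂ P ψ hψ hP⟩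

end Summit.HodgeConjecture.HodgeConjecture.R90.S8

end
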